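import Mathlib
import Summits.ResolutionOfSingularities.ResolutionOfSingularities.Theorems.RadicialJungCleanModelsContactChainExists
import Summits.ResolutionOfSingularities.ResolutionOfSingularities.Theorems.RadicialJungCleanModelsContactChainContaining
import HarnessLib

/-!
# Route `RadicialJung`, crux `CleanModels` (stmt-ResolutionOfSingularities-15917), line `Sketch` rev 35, stub 6 `stub_cleanProp44` (X44c),
# work plan O8 / L7b: DOMINANT chains exist, and the packaged exit «some chain of point blowing ups makes the curve clean-permissible»

`Theorems/RadicialJungCleanModelsContactChainExists.lean` (✓ p693217) constructs chains of point blowing ups following a regular curve to any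
length but does not record that the composite `σ : X → X₀` is DOMINANT (listed there as missing; the clean bookkeeping
`RatFn.functionFieldMap σ` needs it).  This file adds it and packages the exit of L7b in the form the X44c assembly consumes:

* `vanishingIdeal_singleton_ne_bot_of_not_isField` — on an integral scheme the ideal of a closed point whose local ring is not a field is
  non-zero (else the point would be generic);
* `isDominant_of_isBlowup_of_ne_bot` — a blowing up of an integral scheme along a non-zero ideal is dominant (universe-polymorphic copy of
  the `EquisingularLift` lemma `isDominant_of_isBlowup`: the image contains the dense complement of the centre);
* `exists_pointChainAlong_isDominant` — chains of ANY length exist with `σ` dominant, `X` integral locally Noetherian, end point closed over `x₀`;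
* `exists_pointChain_cleanPermissibleAt` — **the L7b exit, packaged**: `X₀` regular integral locally Noetherian, `C₀` a regular curve through
  the closed point `x₀` (`dim 𝒪_{X₀,x₀} = 3`), the line of `G` presented at `x₀` as `u₀ · t₁^{α₁} t₂^{α₂} · ∏_i (γ_i w^{k_i} + s₀ᵢ)^{a_i}`
  (`(t₁,t₂)` a pair, part of a regular system of parameters, generating `𝓘_{C₀,x₀}`; `w` transversal; `γ_i, u₀` units; `s₀ᵢ ∈ 𝓘_{C₀,x₀}`).
  If SOME `α_j` is prime to `p`, or `p ∤ Σ_i k_i a_i`, then there is a dominant chain of `max_i k_i` point blowing ups following the curve at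
  whose end point `x` (closed, over `x₀`) the line of `σ^♯ G` is CLEAN-PERMISSIBLE for the strict transform `C`
  (`cleanPermissibleAt_of_pointChain_containing`, ✓ p812266).  What this does NOT cover (rest of O8): `p ∣ α₁, α₂` AND `p ∣ Σ k_i a_i`
  (the uncharged landing: form (2) exit ✓ `cleanPermissibleAt_of_unit`, else restart; termination = memo 4e (B′)/(B5′)).

Honest framing: OURS (elementary); nothing here proves resolution in characteristic `p`, X44c, or any case of `CleanModels`.
-/

noncomputable section

set_option linter.dupNamespace false -- mandated namespace of this single-conjunct summit

open CategoryTheory AlgebraicGeometry TopologicalSpace IsLocalRing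
open Literature.AlgebraicGeometry.Resolution Literature.AlgebraicGeometry.Motives
open Scheme.IdealSheafData

universe u

namespace Summit.ResolutionOfSingularities.ResolutionOfSingularities.Theorems.RadicialJung.CleanModels

/-- On an integral scheme, the ideal of a closed point whose local ring is not a field is non-zero (else its support `{x}` would be
the whole space and `x` the generic point, whose local ring is the function field). [folklore] -/
theorem vanishingIdeal_singleton_ne_bot_of_not_isField {X : Scheme.{u}} [IsIntegral X] {x : X} (hx : IsClosed ({x} : Set X))
    (hxf : ¬ IsField (X.presheaf.stalk x)) : vanishingIdeal (⟨{x}, hx⟩ : Closeds X) ≠ ⊥ := by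
  intro h
  have hsupp : (((vanishingIdeal (⟨{x}, hx⟩ : Closeds X)).support : Closeds X) : Set X) = {x} :=
    coe_support_vanishingIdeal _
  rw [h, Scheme.IdealSheafData.support_bot, Closeds.coe_top] at hsupp
  have hgen : genericPoint X = x := by
    have : genericPoint X ∈ ({x} : Set X) := hsupp ▸ Set.mem_univ _
    simpa using this
  apply hxf
  rw [← hgen]
  exact Semifield.toIsField _

/-- **A blowing up of an integral scheme along a non-zero ideal sheaf is dominant**: its image contains the dense open complement of
the centre, over which the blowing up is an isomorphism (`IsBlowup.isIso_compl`).  Universe-polymorphic twin of the `EquisingularLift`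
lemma `isDominant_of_isBlowup`. [folklore] -/
theorem isDominant_of_isBlowup_of_ne_bot {X' X : Scheme.{u}} {π : X' ⟶ X} {J : X.IdealSheafData} [IsIntegral X]
    (hπ : IsBlowup π J) (hJ : J ≠ ⊥) : IsDominant π := by
  haveI : IsIso (π ∣_ centreCompl J) := hπ.isIso_compl
  have hsub : ((centreCompl J : X.Opens) : Set X) ⊆ Set.range π := by
    intro x hx
    obtain ⟨z, hz⟩ := (π ∣_ centreCompl J).surjective ⟨x, hx⟩
    refine ⟨z.1, ?_⟩
    have h := morphismRestrict_base_coe π (centreCompl J) z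
    rw [hz] at h
    exact h.symm
  exact ⟨((centreCompl J).2.dense (centreCompl_nonempty hJ)).mono hsub⟩

/-- **Dominant chains of point blowing ups following a regular curve exist, to any length** (`exists_pointChainAlong` with the
dominance of the composite recorded). [cite: CossartPiltant2008, Prop. 4.4 (proof, p. 10)] -/
theorem exists_pointChainAlong_isDominant {X₀ : Scheme.{u}} [IsIntegral X₀] [IsLocallyNoetherian X₀] (hX₀ : Scheme.IsRegular X₀)
    {C₀ : Closeds X₀} (hC₀reg : ∀ y ∈ (C₀ : Set X₀), ∃ c : Fin 2 → X₀.presheaf.stalk y,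
      IsRsopPart c ∧ Ideal.span (Set.range c) = stalkIdeal (vanishingIdeal C₀) y)
    {x₀ : X₀} (hx₀ : IsClosed ({x₀} : Set X₀)) (hx₀C : x₀ ∈ (C₀ : Set X₀)) (hdim₀ : ringKrullDim (X₀.presheaf.stalk x₀) = 3)
    (n : ℕ) :
    ∃ (X : Scheme.{u}) (_ : IsIntegral X) (_ : IsLocallyNoetherian X) (σ : X ⟶ X₀) (_ : IsDominant σ) (C : Closeds X) (x : X),
      IsPointChainAlong σ C₀ C x n ∧ σ x = x₀ ∧ IsClosed ({x} : Set X) := by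
  induction n with
  | zero => exact ⟨X₀, inferInstance, inferInstance, 𝟙 X₀, inferInstance, C₀, x₀, IsPointChainAlong.nil C₀ x₀, rfl, hx₀⟩
  | succ n ih =>
    obtain ⟨X, hXint, hXnoeth, σ, hσdom, C, x, hchain, hσx, hxcl⟩ := ih
    have hxC₀ : σ x ∈ (C₀ : Set X₀) := by rw [hσx]; exact hx₀C
    have hdimσ : ringKrullDim (X₀.presheaf.stalk (σ x)) = 3 := by rw [hσx]; exact hdim₀
    obtain ⟨hX, hCreg, hxC, hdim⟩ := data_along_pointChain hchain hX₀ hC₀reg hxC₀ hdimσ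
    obtain ⟨hint, hnoeth, x', hτx', hx'mem, hx'cl⟩ := exists_point_strictTransform_over hX hCreg hxcl hxC hdim
    -- re-index everything at `τ x'` (`= x`)
    set τ := blowup.π (vanishingIdeal (⟨{x}, hxcl⟩ : Closeds X)) with hτdef
    have hxcl' : IsClosed ({τ x'} : Set X) := by rw [hτx']; exact hxcl
    have hYeq : (⟨{τ x'}, hxcl'⟩ : Closeds X) = ⟨{x}, hxcl⟩ :=
      Closeds.ext (by change ({τ x'} : Set X) = ({x} : Set X); rw [hτx'])
    have hτ : IsBlowup τ (vanishingIdeal (⟨{τ x'}, hxcl'⟩ : Closeds X)) := by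
      rw [hYeq]; exact blowup.isBlowup _
    have hchain' : IsPointChainAlong σ C₀ C (τ x') n := by rw [hτx']; exact hchain
    have hx'mem' : x' ∈ closure (τ ⁻¹' ((C : Set X) \ {τ x'})) := by rw [hτx']; exact hx'mem
    -- dominance of the new step: the centre is a closed point with a three-dimensional local ring
    have hne : vanishingIdeal (⟨{x}, hxcl⟩ : Closeds X) ≠ ⊥ :=
      vanishingIdeal_singleton_ne_bot_of_not_isField hxcl fun hf => by
        have h0 := ringKrullDim_eq_zero_of_isField hf
        rw [hdim] at h0
        exact absurd h0 (by decide)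
    haveI : IsDominant τ := isDominant_of_isBlowup_of_ne_bot (blowup.isBlowup _) hne
    refine ⟨_, hint, hnoeth, τ ≫ σ, inferInstance, _, x',
      IsPointChainAlong.cons σ C₀ C n τ x' hxcl' hchain' (isRegular_subscheme_vanishingIdeal_singleton hxcl') hτ hx'mem', ?_, hx'cl⟩
    rw [Scheme.Hom.comp_apply, hτx']
    exact hσx

/-- **L7b exit, packaged.**  See the module docstring. [cite: CossartJannsenSaito2020, proof of Thm. 6.28, Step 5]
[cite: CossartPiltant2008, Prop. 4.4 (proof, p. 10)] -/
theorem exists_pointChain_cleanPermissibleAt {X₀ : Scheme.{u}} [IsIntegral X₀] [IsLocallyNoetherian X₀] (hX₀ : Scheme.IsRegular X₀)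
    {C₀ : Closeds X₀} (hC₀reg : ∀ y ∈ (C₀ : Set X₀), ∃ c : Fin 2 → X₀.presheaf.stalk y,
      IsRsopPart c ∧ Ideal.span (Set.range c) = stalkIdeal (vanishingIdeal C₀) y)
    {x₀ : X₀} (hx₀ : IsClosed ({x₀} : Set X₀)) (hx₀C : x₀ ∈ (C₀ : Set X₀)) (hdim₀ : ringKrullDim (X₀.presheaf.stalk x₀) = 3)
    (p : ℕ) (G : X₀.functionField) (cc : Fin p → X₀.functionField) (hcc : ∃ j : Fin p, (j : ℕ) ≠ 0 ∧ cc j ≠ 0)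
    (w u₀ : X₀.presheaf.stalk x₀) (hw : stalkIdeal (vanishingIdeal C₀) x₀ ⊔ Ideal.span {w} = maximalIdeal _)
    (hu₀ : IsUnit u₀) (t : Fin 2 → X₀.presheaf.stalk x₀) (ht : IsRsopPart t)
    (htP : Ideal.span (Set.range t) = stalkIdeal (vanishingIdeal C₀) x₀) (α : Fin 2 → ℕ)
    {m : ℕ} (γ s₀ : Fin m → X₀.presheaf.stalk x₀) (hγ : ∀ i, IsUnit (γ i))
    (hs₀ : ∀ i, s₀ i ∈ stalkIdeal (vanishingIdeal C₀) x₀) (k a : Fin m → ℕ)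
    (hcharge : (∃ j, ¬ p ∣ α j) ∨ ¬ p ∣ ∑ i, k i * a i)
    (hX : (∑ j : Fin p, cc j ^ p * G ^ (j : ℕ)) =
      RatFn.toFunctionField x₀ (u₀ * (∏ j, t j ^ α j) * ∏ i, (γ i * w ^ k i + s₀ i) ^ a i)) :
    ∃ (X : Scheme.{u}) (_ : IsIntegral X) (_ : IsLocallyNoetherian X) (σ : X ⟶ X₀) (_ : IsDominant σ) (C : Closeds X) (x : X),
      IsPointChainAlong σ C₀ C x (Finset.univ.sup k) ∧ σ x = x₀ ∧ IsClosed ({x} : Set X) ∧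
      CleanPermissibleAt p (RatFn.toFunctionField x) (RatFn.functionFieldMap σ G) (stalkIdeal (vanishingIdeal C) x) := by
  obtain ⟨X, hXint, hXnoeth, σ, hσdom, C, x, hchain, hσx, hxcl⟩ :=
    exists_pointChainAlong_isDominant hX₀ hC₀reg hx₀ hx₀C hdim₀ (Finset.univ.sup k)
  subst hσx
  refine ⟨X, hXint, hXnoeth, σ, hσdom, C, x, hchain, rfl, hxcl, ?_⟩
  have hkn : ∀ i, k i ≤ Finset.univ.sup k := fun i => Finset.le_sup (Finset.mem_univ i)
  refine cleanPermissibleAt_of_pointChain_containing hchain hX₀ hC₀reg hx₀C hdim₀ p G cc hcc w u₀ hw hu₀ t ht htP α γ s₀ hγ hs₀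
    k a hkn ?_ hX
  rcases hcharge with h1 | h2
  · exact Or.inl h1
  · by_cases hα : ∃ j, ¬ p ∣ α j
    · exact Or.inl hα
    · push Not at hα
      refine Or.inr fun hdiv => h2 ?_
      have hsum : p ∣ Finset.univ.sup k * ∑ j, α j := Dvd.dvd.mul_left (Finset.dvd_sum fun j _ => hα j) _
      exact (Nat.dvd_add_right hsum).mp hdiv

end Summit.ResolutionOfSingularities.ResolutionOfSingularities.Theorems.RadicialJung.CleanModels

end
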